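import Mathlib
import Literature.Analysis.FluidPDE.TypeIAncientMild
import Literature.Analysis.FluidPDE.TypeIAncientMildRescale
import Literature.Analysis.FluidPDE.OseenMildUniqueness
import Literature.Analysis.FluidPDE.GigaMiura2011ScaledAlignmentBlowupLimitHolds
import HarnessLib

/-!
# Census row A8t, line «pitch-defect»: the two known-type stubs S2 and S4

Support file for the scenario census of `NavierStokesRegularity` (row A8t,
`Summit.NavierStokesRegularity.NavierStokesRegularity.Theorems.ScenarioCensus.Row_A8t`: time-Type-I
helical ancient mild solutions have a.e. constant slices) along the ideator line «pitch-defect»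
(ns-idea-2 g7 rev 2, critic idea-crit-3 PASS-WITH-PRICE; KEY-NS #101 (2): stubs land BY NAME
`--supports stmt-NavierStokesRegularity-10661 --as helper`). Two of its six registered stubs are
known-type statements about the tree's Oseen-gauge Type-I class
`Literature.Analysis.FluidPDE.IsTypeIAncientMild C V` (jointly smooth, divergence free,
`V(t) = e^{(t−s)Δ}V(s) − B¹ₛ(V,V)(t)` for all `s < t < 0`, `‖V(t,x)‖ ≤ C/√(−t)`); both are PROVED
here from landed tree theorems:

* `typeIAncientMild_forwardUniqueness` = stub **S4** `stub_forwardUniqueness` (same signature, see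
  `stub_forwardUniqueness`): a member vanishing on every slice before some `T < 0` vanishes on every
  slice — the strong Oseen formula from a zero slice reads `V(t) = −B¹ₛ(V,V)(t)`, the zero field solves
  the same equation, and bounded solutions of the Oseen integral equation with the same free term are
  unique (`Literature.Analysis.FluidPDE.oseenMild_bounded_unique`, Koch–Nadirashvili–Seregin–Šverák
  2009 §4 / Giga–Inui–Matsui 1999) on every window `(s, t/2)` where `V` is bounded; continuity of the
  slices upgrades a.e. to everywhere.
* `typeIAncientMild_gradient_bound` = stub **S2** `stub_typeIGradient`: `‖∇V(t)‖_∞ ≤ C₁/(−t)` with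
  ONE constant `C₁ = C₁(C)`. Proof by scaling: the parabolic zoom `V_λ = λV(λ²·, λ·)`,
  `λ = √(−t)`, is again in the class with the SAME constant
  (`Literature.Analysis.FluidPDE.IsTypeIAncientMild.nsRescale`), its past shift by `1/2` is a
  bounded (`≤ C√2`) continuous Oseen-mild field on `(−∞, 0)`, to which the uniform window bound
  `Literature.Analysis.FluidPDE.exists_norm_iteratedFDeriv_le_of_bounded_oseenMild` (KNSS 2009,
  Prop. 4.1 / (4.10), constant `K(C√2, 1, 1, 1/2)` independent of the field) applies at time `−1/2`;
  un-zooming gives `‖∇V(t, x)‖ = ‖∇V_λ(−1, x/λ)‖/λ² ≤ K/(−t)`.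

No summit statement and no census row is proved in this file; nothing here is a claim about
Navier–Stokes regularity.

## References

* G. Koch, N. Nadirashvili, G. Seregin, V. Šverák, *Liouville theorems for the Navier–Stokes
  equations and applications*, Acta Math. 203 (2009) 83–105 = arXiv:0709.3599, §4 p. 8 (Prop. 4.1,
  (4.3)–(4.4), (4.6), (4.10)). [KochNadirashviliSereginSverak2009]
-/

-- the summit and its single problem share the name (D-0017 nested layout)
set_option linter.dupNamespace false

noncomputable section

open MeasureTheory Set Function Filter
open scoped Topology ENNReal NNReal

namespace Summit.NavierStokesRegularity.NavierStokesRegularity.Theorems.ScenarioCensus.PitchDefect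

open Literature.Analysis Literature.Analysis.FluidPDE

/-! ### S4: forward unique continuation from zero -/

/-- **S4 (forward uniqueness from a zero past).** A Type-I ancient mild field in the Oseen gauge
which vanishes on every slice before some `T` (WLOG `T < 0`) vanishes on every slice `t < 0`: on the window
`(T − 1, t/2)` the field is bounded by `C/√(−t/2)`, solves `V(τ) = e^{(τ−s)Δ}0 − B¹ₛ(V,V)(τ)
= −B¹ₛ(V,V)(τ)` (`s = T − 1`), as does the zero field, so `V(τ) = 0` a.e. by
`oseenMild_bounded_unique`, and everywhere by continuity of the slice. [folklore] -/
theorem typeIAncientMild_forwardUniqueness {C T : ℝ}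
    {V : ℝ → EuclideanSpace ℝ (Fin 3) → EuclideanSpace ℝ (Fin 3)}
    (hV : IsTypeIAncientMild C V) (h0 : ∀ t < T, ∀ x, V t x = 0) :
    ∀ t < 0, ∀ x, V t x = 0 := by
  intro t ht
  by_cases htT : t < T
  · exact h0 t htT
  -- the window `(s, T')`, `s = T - 1`, `T' = t / 2`
  set s : ℝ := T - 1 with hs_def
  set T' : ℝ := t / 2 with hT'_def
  have hsT : s < T := by rw [hs_def]; linarith
  have hst : s < t := lt_of_lt_of_le hsT (not_lt.1 htT)
  have htT' : t < T' := by rw [hT'_def]; linarith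
  have hT'0 : T' < 0 := by rw [hT'_def]; linarith
  have hVs : V s = fun _ => (0 : EuclideanSpace ℝ (Fin 3)) := funext fun y => h0 s hsT y
  -- the common bound on the window
  set M : ℝ := C / Real.sqrt (-T') with hM_def
  have hM0 : 0 ≤ M := div_nonneg hV.nonneg (Real.sqrt_nonneg _)
  have hVM : ∀ τ ∈ Ioo s T', ∀ y, ‖V τ y‖ ≤ M := fun τ hτ y => hV.norm_le_of_mem_Ioo hT'0 hτ y
  have h0M : ∀ τ ∈ Ioo s T', ∀ y,
      ‖(fun (_ : ℝ) (_ : EuclideanSpace ℝ (Fin 3)) => (0 : EuclideanSpace ℝ (Fin 3))) τ y‖ ≤ M :=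
    fun τ _ y => by simpa using hM0
  have hum := hV.aestronglyMeasurable_uncurry (s := s) hT'0.le
  have hvm : AEStronglyMeasurable
      (uncurry fun (_ : ℝ) (_ : EuclideanSpace ℝ (Fin 3)) => (0 : EuclideanSpace ℝ (Fin 3)))
      ((volume : Measure (ℝ × EuclideanSpace ℝ (Fin 3))).restrict (Ioo s T' ×ˢ univ)) :=
    aestronglyMeasurable_const
  -- both `V` and `0` solve `w(τ) = 0 - B¹ₛ(w,w)(τ)` on the window
  have hu : ∀ τ ∈ Ioo s T', V τ =ᵐ[volume] fun y =>
      (fun (_ : ℝ) (_ : EuclideanSpace ℝ (Fin 3)) => (0 : EuclideanSpace ℝ (Fin 3))) τ y -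
        oseenDuhamel 1 s V V τ y := by
    intro τ hτ
    refine Eventually.of_forall fun y => ?_
    have key := hV.mild_eq_heatExtension hτ.1 (hτ.2.trans hT'0) y
    rw [hVs, UnboundedOperators.heatExtension_const _ (sub_pos.2 hτ.1)] at key
    exact key
  have hv : ∀ τ ∈ Ioo s T',
      (fun (_ : ℝ) (_ : EuclideanSpace ℝ (Fin 3)) => (0 : EuclideanSpace ℝ (Fin 3))) τ =ᵐ[volume]
        fun y => (fun (_ : ℝ) (_ : EuclideanSpace ℝ (Fin 3)) => (0 : EuclideanSpace ℝ (Fin 3))) τ y -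
          oseenDuhamel 1 s (fun (_ : ℝ) (_ : EuclideanSpace ℝ (Fin 3)) => (0 : EuclideanSpace ℝ (Fin 3)))
            (fun (_ : ℝ) (_ : EuclideanSpace ℝ (Fin 3)) => (0 : EuclideanSpace ℝ (Fin 3))) τ y := by
    intro τ _
    refine Eventually.of_forall fun y => ?_
    have e : (fun (_ : ℝ) (_ : EuclideanSpace ℝ (Fin 3)) => (0 : EuclideanSpace ℝ (Fin 3))) =
        (0 : ℝ → EuclideanSpace ℝ (Fin 3) → EuclideanSpace ℝ (Fin 3)) := rfl
    rw [e, oseenDuhamel_zero_left]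
    simp
  have key := oseenMild_bounded_unique one_pos hM0 hum hvm hVM h0M hu hv t ⟨hst, htT'⟩
  -- a.e. to everywhere, by continuity of the slice
  have hcont : Continuous (V t) := hV.continuous_slice ht
  have heq : V t = fun _ => (0 : EuclideanSpace ℝ (Fin 3)) :=
    (Continuous.ae_eq_iff_eq volume hcont continuous_const).1 key
  intro x
  rw [heq]

/-- **Stub S4 of the line «pitch-defect», BY NAME and with the registered signature**
(`stub_forwardUniqueness` of `pub/ideators/ns-idea-2/lines/pitch-defect/line-pitch-defect.lean`,
rev 2): forward unique continuation from a zero past for the Oseen-gauge Type-I class. [folklore] -/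
theorem stub_forwardUniqueness :
    ∀ (C T : ℝ) (V : ℝ → EuclideanSpace ℝ (Fin 3) → EuclideanSpace ℝ (Fin 3)),
      FluidPDE.IsTypeIAncientMild C V → T < 0 →
      (∀ t < T, ∀ x : EuclideanSpace ℝ (Fin 3), V t x = 0) →
        ∀ t < 0, ∀ x : EuclideanSpace ℝ (Fin 3), V t x = 0 :=
  fun _ _ _ hV _ h0 => typeIAncientMild_forwardUniqueness hV h0

/-! ### S2: the Type-I gradient bound by scaling -/

/-- The derivative of the zoomed slice `y ↦ λ • f(λ • y)` at `y` is `λ² • Df(λ • y)`, so its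
operator norm is `λ² ‖Df(λ • y)‖` (`λ ≥ 0`). [folklore] -/
theorem norm_fderiv_smul_comp_smul {f : EuclideanSpace ℝ (Fin 3) → EuclideanSpace ℝ (Fin 3)}
    (hf : Differentiable ℝ f) {lam : ℝ} (hlam : 0 ≤ lam) (y : EuclideanSpace ℝ (Fin 3)) :
    ‖fderiv ℝ (fun z : EuclideanSpace ℝ (Fin 3) => lam • f (lam • z)) y‖ =
      lam ^ 2 * ‖fderiv ℝ f (lam • y)‖ := by
  set L : EuclideanSpace ℝ (Fin 3) →L[ℝ] EuclideanSpace ℝ (Fin 3) :=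
    lam • ContinuousLinearMap.id ℝ (EuclideanSpace ℝ (Fin 3)) with hL
  have hLy : ∀ z : EuclideanSpace ℝ (Fin 3), L z = lam • z := fun z => by simp [hL]
  have h1 : HasFDerivAt f (fderiv ℝ f (lam • y)) (L y) := by
    rw [hLy]
    exact (hf (lam • y)).hasFDerivAt
  have h2 : HasFDerivAt (fun z : EuclideanSpace ℝ (Fin 3) => f (L z))
      ((fderiv ℝ f (lam • y)).comp L) y := h1.comp y L.hasFDerivAt
  have h3 : HasFDerivAt (fun z : EuclideanSpace ℝ (Fin 3) => lam • f (L z))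
      (lam • (fderiv ℝ f (lam • y)).comp L) y := h2.const_smul lam
  have e : (fun z : EuclideanSpace ℝ (Fin 3) => lam • f (lam • z)) =
      fun z : EuclideanSpace ℝ (Fin 3) => lam • f (L z) := by
    funext z; rw [hLy]
  rw [e, h3.fderiv]
  have hcomp : (fderiv ℝ f (lam • y)).comp L = lam • fderiv ℝ f (lam • y) := by
    rw [hL, ContinuousLinearMap.comp_smul, ContinuousLinearMap.comp_id]
  rw [hcomp, smul_smul, norm_smul, Real.norm_of_nonneg (mul_nonneg hlam hlam), sq]

/-- **S2 (Type-I gradient bound).** For a Type-I ancient mild field in the Oseen gauge with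
constant `C` there is `C₁ = C₁(C)` with `‖∇V(t, x)‖ ≤ C₁/(−t)` for all `t < 0` and `x`: the
parabolic zoom `V_λ = λV(λ²·, λ·)`, `λ = √(−t)`, is in the class with the same constant
(`IsTypeIAncientMild.nsRescale`), its shift `s ↦ V_λ(s − 1/2)` is a continuous Oseen-mild field
bounded by `C√2` on `(−∞,0)`, so the uniform window bound
`exists_norm_iteratedFDeriv_le_of_bounded_oseenMild` (KNSS 2009, Prop. 4.1 / (4.10)) bounds
`‖∇V_λ(−1)‖` by a constant `K` depending only on `C`; and `∇V(t, x) = λ⁻²∇V_λ(−1, x/λ)`.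
[cite: KochNadirashviliSereginSverak2009, Prop. 4.1 with (4.6), (4.10) (arXiv:0709.3599 p. 8)] -/
theorem typeIAncientMild_gradient_bound {C : ℝ}
    {V : ℝ → EuclideanSpace ℝ (Fin 3) → EuclideanSpace ℝ (Fin 3)} (hV : IsTypeIAncientMild C V) :
    ∃ C₁ : ℝ, ∀ t < 0, ∀ x, ‖fderiv ℝ (V t) x‖ ≤ C₁ / (-t) := by
  obtain ⟨K, hK⟩ := exists_norm_iteratedFDeriv_le_of_bounded_oseenMild (C * Real.sqrt 2) 1
    (ℓ := 1) (δ := 1 / 2) one_pos (by norm_num)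
  refine ⟨K, fun t ht x => ?_⟩
  -- the zoom at scale `λ = √(-t)` and its past shift by `1/2`
  set lam : ℝ := Real.sqrt (-t) with hlam_def
  have hlam : 0 < lam := Real.sqrt_pos.2 (by linarith)
  have hlam2 : lam ^ 2 = -t := Real.sq_sqrt (by linarith)
  have hZ : IsTypeIAncientMild C (FluidPDE.nsRescale lam V) := hV.nsRescale hlam
  set W : ℝ → EuclideanSpace ℝ (Fin 3) → EuclideanSpace ℝ (Fin 3) :=
    fun s => FluidPDE.nsRescale lam V (s - 1 / 2) with hW_def
  have hW : IsTypeIAncientMild C W := hZ.comp_sub_right (δ := 1 / 2) (by norm_num)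
  have hWc : ContinuousOn (uncurry W) (Ioo (-2 : ℝ) 0 ×ˢ univ) :=
    hW.continuousOn_uncurry.mono (prod_mono Ioo_subset_Iio_self Subset.rfl)
  have hWdiv : ∀ τ ∈ Ioo (-2 : ℝ) 0, IsWeaklyDivFree (W τ) := fun τ hτ => hW.isWeaklyDivFree hτ.2
  have hWmild : ∀ s' t' : ℝ, (-2 : ℝ) < s' → s' < t' → t' < 0 → ∀ y,
      W t' y = UnboundedOperators.heatExtension (W s') (t' - s') y - oseenDuhamel 1 s' W W t' y :=
    fun s' t' _ hst ht' y => hW.mild_eq_heatExtension hst ht' y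
  have hWbd : ∀ τ ∈ Ioo (-2 : ℝ) 0, ∀ y, ‖W τ y‖ ≤ C * Real.sqrt 2 := by
    intro τ hτ y
    have h1 : ‖FluidPDE.nsRescale lam V (τ - 1 / 2) y‖ ≤ C / Real.sqrt (-(τ - 1 / 2)) :=
      hZ.norm_le (by linarith [hτ.2]) y
    have h2 : Real.sqrt (1 / 2) ≤ Real.sqrt (-(τ - 1 / 2)) := Real.sqrt_le_sqrt (by linarith [hτ.2])
    have h3 : C / Real.sqrt (-(τ - 1 / 2)) ≤ C / Real.sqrt (1 / 2) :=
      div_le_div_of_nonneg_left hV.nonneg (Real.sqrt_pos.2 (by norm_num)) h2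
    have h4 : C / Real.sqrt (1 / 2) = C * Real.sqrt 2 := by
      rw [div_eq_iff (Real.sqrt_pos.2 (by norm_num : (0:ℝ) < 1 / 2)).ne', mul_assoc,
        ← Real.sqrt_mul (by norm_num : (0:ℝ) ≤ 2)]
      norm_num
    exact h1.trans (h3.trans h4.le)
  -- the uniform window bound at time `-1/2` (window `a = -5/4`, `ℓ = 1`, `δ = 1/2`)
  have hwin := hK (A := -2) (a := -5 / 4) (u := W) (by norm_num) (by norm_num) hWc hWdiv hWmild hWbd
    (-1 / 2) ⟨by norm_num, by norm_num⟩ (lam⁻¹ • x)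
  have hslice : W (-1 / 2) = fun z => lam • V t (lam • z) := by
    funext z
    simp only [hW_def, FluidPDE.nsRescale_apply]
    congr 2
    rw [hlam2]; ring
  rw [hslice] at hwin
  -- `‖D¹‖ = ‖fderiv‖`
  rw [← norm_iteratedFDeriv_fderiv, norm_iteratedFDeriv_zero] at hwin
  have hdiff : Differentiable ℝ (V t) :=
    (hV.contDiff_slice ht).differentiable (by simp)
  rw [norm_fderiv_smul_comp_smul hdiff hlam.le, smul_inv_smul₀ hlam.ne', hlam2] at hwin
  -- `(-t) ‖∇V(t,x)‖ ≤ K`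
  rw [le_div_iff₀ (by linarith : (0:ℝ) < -t), mul_comm]
  exact hwin

/-- **Stub S2 of the line «pitch-defect», BY NAME and with the registered signature**
(`stub_typeIGradient` of `line-pitch-defect.lean` rev 2): the Type-I gradient bound
`‖∇V(t)‖_∞ ≤ C₁/(−t)` for the Oseen-gauge Type-I class. [cite: KochNadirashviliSereginSverak2009, Prop. 4.1 with (4.6) (arXiv:0709.3599 p. 8)] -/
theorem stub_typeIGradient :
    ∀ (C : ℝ) (V : ℝ → EuclideanSpace ℝ (Fin 3) → EuclideanSpace ℝ (Fin 3)),
      FluidPDE.IsTypeIAncientMild C V →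
        ∃ C₁ : ℝ, ∀ t < 0, ∀ x : EuclideanSpace ℝ (Fin 3), ‖fderiv ℝ (V t) x‖ ≤ C₁ / (-t) :=
  fun _ _ hV => typeIAncientMild_gradient_bound hV

end Summit.NavierStokesRegularity.NavierStokesRegularity.Theorems.ScenarioCensus.PitchDefect

end
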